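import Summits.QuantumFields.YangMills.Theorems.UnitScaleTiltProp7SymCentreAbelianDict
import Summits.QuantumFields.YangMills.Theorems.AlphaInputsT3ACv3LinearLiftTorusLip
import HarnessLib

/-!
# Route `UnitScaleTilt`, crux K1 child «MinimiserStabilityRegPr» (stmt-QuantumFields-19200), stub `stub_existenceMinimalOrbit` (EX), line «SYM-CENTRE» row (R4) —
# **«CS-ARITH»: THE SMOOTH EXACT LIFT, EXPONENTIATED ALONG `iσ₃`, IS PRINT-REGULAR WITH AN ABSOLUTE RADIUS** — `(R3) ∘ (R4)-DICT` with every constant discharged: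
# for every coarse real one-form `A` on `T^{(K−n)}` with `|curlAt A| ≤ ε` (`ε > 0`) there is a finest one-form `a` with EXACT `(K−n)`-fold (0.4)-linear average `A` such that
# `b ↦ e^{a(b)·iσ₃} = diag(e^{ia}, e^{−ia})` lies in `𝔘_{K−n}(CS·ε)`, `CS = 2·10⁶` (`RegPr F n K (2·10⁶·ε) (gexpAt (suGroupModel 2) iσ₃ a)`).

Cell `ym3-torus`, width seat `ym3-torus-px19` (g3).  `--supports stmt-QuantumFields-19200 --as helper`; THEOREMS ONLY (0 `def`, 0 `sorry`); count-neutral; nothing here claims the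
stub, the crux, d = 4 or the mass gap — YM₃ on T³ is a ladder rung (R3), not the Clay problem.

WHAT.  ★★★ `exists_lift_regPr_gexpAt_sigma3` = ✓`LinearLiftSpreadLip.exists_smoothExactLift_torus` (rows `|curlAt a| ≤ 54³·ε/(L^k)²`, `|curlAt a (x+e_λ) − curlAt a x| ≤
330·54²·ε/(L^k)³`, `k = K − n`, `d = 3`) ∘ ✓`Prop7SymCentreAbelianDict.regPr_gexpAt_of_curl_rows` (windows `‖iσ₃‖·δ₁ < CS·ε·L^{−2k}`, `2·‖iσ₃‖·δ₂ < CS·ε·L^{−3k}`, with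
✓`norm_I_smul_sigma3_le_one`): `54³ = 157464 < 2·10⁶` and `2·330·54² = 1924560 < 2·10⁶`.  The radius `CS·ε` is the LETTER `CS` of the displayed `hSymCentre` (RULING
★w2-19200 g6 2026-08-28T22:08:41Z) — crude-absolute by design (true value `≈ 1.3·10⁴`, LOCATE #57 of seat px20 g2).  Also re-exported: the lift's own two curl rows at `d = 3`.
HONEST SCOPE.  Arithmetic on landed theorems; nothing of [Balaban1985Variational]∕[Balaban1987RG1] asserted.  NOT here: the fibre identity `D_{n,K}(e^{a·iσ₃}) = e^{A·iσ₃}`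
(R4-FIBRE, ym-ust-20520-w4 g9), the flux part (✓`LinearLiftFlux`, ym-ust-20520-w5 g8), the diagonalising gauge and `hLift` (★px6 g3 ∕ ★px20 g2) — the (R4) assembly.

References: T. Bałaban, CMP **102** (1985) 277–309 [Balaban1985Variational] ((2)+(6) p.278: `𝔘_k(ε₀)`); CMP **109** (1987) 249–301 [Balaban1987RG1] ((0.4) p.253);
CMP **98** (1985) 17–51 [Balaban1985Averaging] ((24) p.21).
-/

set_option autoImplicit false

noncomputable section

open scoped Matrix.Norms.L2Operator

namespace Summit.QuantumFields.YangMills.Theorems.Prop7SymCentreAbelianDict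

open Literature.MathematicalPhysics.QuantumFieldTheory.Balaban1983to89
open Literature.MathematicalPhysics.QuantumFieldTheory.Balaban1983to89.B9AdOrthogonal (σ₃)
open Literature.MathematicalPhysics.QuantumFieldTheory.Balaban1983to89.T3ContinuumYM3Torus
open Literature.MathematicalPhysics.QuantumFieldTheory.Balaban1983to89.T3RegularMinimiser (regThreshold)
open Literature.MathematicalPhysics.QuantumFieldTheory.Balaban1983to89.T3PrintedRegularMinimiser (RegPr)
open Summit.QuantumFields.Balaban3D.Carriers (suGroupModel)
open Summit.QuantumFields.YangMills.Theorems.AbelianEML (gexpAt curlAt linAvgIter)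
open Summit.QuantumFields.YangMills.Theorems.LinearLiftSpreadLip (exists_smoothExactLift_torus)

/-- `((x^k))⁻²∕⁻³` bookkeeping: `c·ε/(x^k)^a = c·ε·(x⁻¹)^{a·k}`. [folklore] -/
theorem div_pow_pow_eq (c ε x : ℝ) (k a : ℕ) : c * ε / (x ^ k) ^ a = c * ε * (x⁻¹) ^ (a * k) := by
  rw [div_eq_mul_inv, ← inv_pow, ← inv_pow, ← pow_mul, mul_comm k a]

/-- **★★★ «CS-ARITH»: THE SMOOTH EXACT LIFT EXPONENTIATED ALONG `iσ₃` IS PRINT-REGULAR WITH THE ABSOLUTE RADIUS `2·10⁶·ε`.**  For the T³ series `F`, run `K`,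
comparison height `n`, and every coarse real one-form `A` on `T^{(K−n)}` with `|curlAt A| ≤ ε`, `0 < ε`: there is a finest real one-form `a` with
`linAvgIter (K − n) a = A` (EXACT), `|curlAt a| ≤ 54³·ε/(L^{K−n})²`, `|curlAt a (x + e_λ) − curlAt a x| ≤ 330·54²·ε/(L^{K−n})³`, and
`RegPr F n K (2·10⁶·ε) (gexpAt (suGroupModel 2) iσ₃ a)` — both clauses of [7] (2)∕(6) for the diagonal field `b ↦ diag(e^{ia(b)}, e^{−ia(b)})`.
[cite: Balaban1985Variational, (2)+(6) p.278; Balaban1987RG1, (0.4) p.253] -/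
theorem exists_lift_regPr_gexpAt_sigma3 (F : T3Family) (n K : ℕ) (A : PBond (F.P K) (K - n) → ℝ) {ε : ℝ} (hε : 0 < ε)
    (hA : ∀ (y : Site (F.P K) (K - n)) (μ ν : Fin (F.P K).d), μ ≠ ν → |curlAt A y μ ν| ≤ ε) :
    ∃ a : PBond (F.P K) 0 → ℝ, linAvgIter (K - n) a = A ∧
      (∀ (x : Site (F.P K) 0) (μ ν : Fin (F.P K).d), μ ≠ ν → |curlAt a x μ ν| ≤ (54 : ℝ) ^ 3 * ε / ((F.L : ℝ) ^ (K - n)) ^ 2) ∧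
      (∀ (x : Site (F.P K) 0) (lam μ ν : Fin (F.P K).d), μ ≠ ν →
        |curlAt a (x.shift lam) μ ν - curlAt a x μ ν| ≤ 330 * (54 : ℝ) ^ 2 * ε / ((F.L : ℝ) ^ (K - n)) ^ 3) ∧
      RegPr F n K (2000000 * ε) (gexpAt (suGroupModel 2) I_smul_sigma3_mem_lie a) := by
  have hk : K - n ≤ (F.P K).m + (F.P K).K := by show K - n ≤ F.m + K; omega
  obtain ⟨a, hav, h1, h2⟩ := exists_smoothExactLift_torus (P := F.P K) (K - n) hk A hA
  have hd : (F.P K).d = 3 := rfl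
  -- `(F.P K).d = 3` and `(F.P K).L = F.L` definitionally: restate the two rows at `d = 3`, block size `F.L`
  have h1' : ∀ (x : Site (F.P K) 0) (μ ν : Fin (F.P K).d), μ ≠ ν → |curlAt a x μ ν| ≤ (54 : ℝ) ^ 3 * ε / ((F.L : ℝ) ^ (K - n)) ^ 2 :=
    fun x μ ν hμν => h1 x μ ν hμν
  have h2' : ∀ (x : Site (F.P K) 0) (lam μ ν : Fin (F.P K).d), μ ≠ ν →
      |curlAt a (x.shift lam) μ ν - curlAt a x μ ν| ≤ 330 * (54 : ℝ) ^ 2 * ε / ((F.L : ℝ) ^ (K - n)) ^ 3 :=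
    fun x lam μ ν hμν => h2 x lam μ ν hμν
  refine ⟨a, hav, h1', h2', ?_⟩
  -- the two windows at `Y = iσ₃`, `‖iσ₃‖ ≤ 1`
  have hLpos : (0 : ℝ) < (F.L : ℝ) := by have := F.hL.2; positivity
  have hq2 : (0 : ℝ) < ((F.L : ℝ)⁻¹) ^ (2 * (K - n)) := by positivity
  have hq3 : (0 : ℝ) < ((F.L : ℝ)⁻¹) ^ (3 * (K - n)) := by positivity
  have hY := norm_I_smul_sigma3_le_one
  have hY0 : (0 : ℝ) ≤ ‖(Complex.I • σ₃ : Matrix (Fin 2) (Fin 2) ℂ)‖ := norm_nonneg _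
  refine regPr_gexpAt_of_curl_rows I_smul_sigma3_mem_lie F n K (2000000 * ε) a h1' h2' ?_ ?_
  · -- plaquette window: `‖iσ₃‖·54³·ε·L^{−2k} < 2·10⁶·ε·L^{−2k}`
    show ‖(Complex.I • σ₃ : Matrix (Fin 2) (Fin 2) ℂ)‖ * ((54 : ℝ) ^ 3 * ε / ((F.L : ℝ) ^ (K - n)) ^ 2) < 2000000 * ε * ((F.L : ℝ)⁻¹) ^ (2 * (K - n))
    rw [div_pow_pow_eq]
    nlinarith [mul_pos hε hq2]
  · -- divergence window: `2·‖iσ₃‖·330·54²·ε·L^{−3k} < 2·10⁶·ε·L^{−3k}`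
    rw [hd, div_pow_pow_eq]
    push_cast
    nlinarith [mul_pos hε hq3]

end Summit.QuantumFields.YangMills.Theorems.Prop7SymCentreAbelianDict

end
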